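import Summits.CriticalPhenomena.CardyFormulaZ2.Theorems.CardyBoundaryCoulombGasHalfPlaneMarkDensityLawPosDensityPositivity
import Summits.CriticalPhenomena.CardyFormulaZ2.Theorems.CardyBoundaryCoulombGasHalfPlaneMarkDensityLawDensityUniform

/-!
# `HalfPlaneMarkDensityLaw` (crux stmt-CriticalPhenomena-5661), line `Sketch`, a-priori programme (lead c12-0):
# stub `stub_lawSeq_uniformPos` — UNIFORM positivity of the lattice mark density on compact intervals
# of the fourth mark

`lawSeq a b c x n = n · P_{1/2}[E_n(a,b,c,x)]` is the crux's sequence (the lattice mark density),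
`E_n(a,b,c,x) = firstHit halfPlane A_n ⌊cn⌋ ⌊xn⌋` (`Density.lawSeq_eq`, definitional).

For `a < b < c < x₀ ≤ x₁` there is `c₁ > 0` with `c₁ ≤ lawSeq a b c x n` for ALL `x ∈ [x₀, x₁]` and all
large `n` (one threshold for the whole interval).  Proof: pointwise positivity
(`TwoArmLower.stub_densityPositivity`: `c(p) ≤ n · P[E_n(p)]` eventually, `c(p) > 0`) + the uniform
`n⁻²`-Lipschitz bound in the position of the fourth mark (`Density.uniformShiftLipschitz` with the
separation scale `4ε = min (b − a, c − b, x₀ − c)` and reference point `x₀`) + compactness of `[x₀, x₁]`: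

* LOCAL STEP (`half_le_of_shiftLipschitz`, pure arithmetic at a fixed `n`): if `|x − p| ≤ δ`,
  `C δ ≤ c(p)/4` and `C ≤ (c(p)/4) · n`, then
  `n · P[E_n(⌊xn⌋)] ≥ n · P[E_n(⌊pn⌋)] − C · |⌊xn⌋ − ⌊pn⌋| / n ≥ c(p) − C δ − C/n ≥ c(p)/2`;
  hence with `δ(p) = c(p) / (4 (C + 1))`: eventually in `n`, `c(p)/2 ≤ lawSeq a b c x n` for every
  `x ≥ x₀` with `|x − p| < δ(p)`;
* COMPACTNESS (`IsCompact.elim_nhds_subcover` for the cover of `[x₀, x₁]` by the balls `B(p, δ(p))`):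
  finitely many centres `t`, `c₁ := min_{p ∈ t} c(p)/2 > 0`, and the eventuality is the finite
  intersection (`Filter.eventually_all_finset`).
-/

noncomputable section

namespace Summit.CriticalPhenomena.CardyFormulaZ2.Cruxes.HalfPlaneMarkDensityLaw.SketchLine

open Literature.Probability.Percolation Literature.Probability.LatticeModels
open MeasureTheory Filter Set
open scoped Topology
open Summit.CriticalPhenomena.CardyFormulaZ2.Theorems.HalfPlaneMarkDensityLaw.Negative

namespace Apriori

/-- **Local step, pure arithmetic at a fixed `n ≥ 1`.** If `g : ℤ → ℝ` is `C n⁻²`-Lipschitz on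
`[⌊x₀n⌋, ∞)`, `x₀ ≤ p`, `x₀ ≤ x`, `|x − p| ≤ δ`, `C δ ≤ c₀/4`, `C ≤ (c₀/4) n` and `c₀ ≤ n · g ⌊pn⌋`, then
`c₀/2 ≤ n · g ⌊xn⌋` (since `|⌊xn⌋ − ⌊pn⌋| ≤ δ n + 1`). [folklore] -/
theorem half_le_of_shiftLipschitz {g : ℤ → ℝ} {n : ℕ} {C x₀ p x c₀ δ : ℝ} (hn1 : 1 ≤ n)
    (hC0 : 0 ≤ C)
    (hL : ∀ k k' : ℤ, ⌊x₀ * n⌋ ≤ k → k ≤ k' → |g k' - g k| ≤ C * (k' - k) / (n : ℝ) ^ 2)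
    (hp : x₀ ≤ p) (hx : x₀ ≤ x) (hxp : |x - p| ≤ δ) (hCδ : C * δ ≤ c₀ / 4)
    (hCn : C ≤ c₀ / 4 * n) (hn : c₀ ≤ n * g ⌊p * n⌋) : c₀ / 2 ≤ n * g ⌊x * n⌋ := by
  have hn' : (0 : ℝ) < n := Nat.cast_pos.2 hn1
  have hx₀x : ⌊x₀ * (n : ℝ)⌋ ≤ ⌊x * n⌋ := Int.floor_le_floor (mul_le_mul_of_nonneg_right hx hn'.le)
  have hx₀p : ⌊x₀ * (n : ℝ)⌋ ≤ ⌊p * n⌋ := Int.floor_le_floor (mul_le_mul_of_nonneg_right hp hn'.le)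
  have hxfl : (⌊x * (n : ℝ)⌋ : ℝ) ≤ x * n := Int.floor_le _
  have hxfl' : x * n < ⌊x * (n : ℝ)⌋ + 1 := Int.lt_floor_add_one _
  have hpfl : (⌊p * (n : ℝ)⌋ : ℝ) ≤ p * n := Int.floor_le _
  have hpfl' : p * n < ⌊p * (n : ℝ)⌋ + 1 := Int.lt_floor_add_one _
  have hxp₁ : x * n - p * n ≤ δ * n := by
    have h := mul_le_mul_of_nonneg_right ((le_abs_self _).trans hxp) hn'.le
    rwa [sub_mul] at h
  have hxp₂ : p * n - x * n ≤ δ * n := by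
    have h := mul_le_mul_of_nonneg_right
      ((le_abs_self _).trans ((abs_sub_comm p x).le.trans hxp)) hn'.le
    rwa [sub_mul] at h
  -- `n² · |g ⌊xn⌋ − g ⌊pn⌋| ≤ C (δ n + 1)`
  have key : (n : ℝ) ^ 2 * |g ⌊x * n⌋ - g ⌊p * n⌋| ≤ C * (δ * n + 1) := by
    rcases le_total ⌊x * (n : ℝ)⌋ ⌊p * (n : ℝ)⌋ with hkm | hmk
    · have h := (le_div_iff₀ (by positivity)).1 (hL _ _ hx₀x hkm)
      have hd : ((⌊p * (n : ℝ)⌋ : ℝ) - ⌊x * (n : ℝ)⌋) ≤ δ * n + 1 := by linarith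
      rw [abs_sub_comm]
      calc (n : ℝ) ^ 2 * |g ⌊p * n⌋ - g ⌊x * n⌋|
          = |g ⌊p * n⌋ - g ⌊x * n⌋| * (n : ℝ) ^ 2 := mul_comm _ _
        _ ≤ C * ((⌊p * (n : ℝ)⌋ : ℝ) - ⌊x * (n : ℝ)⌋) := h
        _ ≤ C * (δ * n + 1) := mul_le_mul_of_nonneg_left hd hC0
    · have h := (le_div_iff₀ (by positivity)).1 (hL _ _ hx₀p hmk)
      have hd : ((⌊x * (n : ℝ)⌋ : ℝ) - ⌊p * (n : ℝ)⌋) ≤ δ * n + 1 := by linarith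
      calc (n : ℝ) ^ 2 * |g ⌊x * n⌋ - g ⌊p * n⌋|
          = |g ⌊x * n⌋ - g ⌊p * n⌋| * (n : ℝ) ^ 2 := mul_comm _ _
        _ ≤ C * ((⌊x * (n : ℝ)⌋ : ℝ) - ⌊p * (n : ℝ)⌋) := h
        _ ≤ C * (δ * n + 1) := mul_le_mul_of_nonneg_left hd hC0
  -- hence `n · |g ⌊xn⌋ − g ⌊pn⌋| ≤ c₀ / 2`
  have h1 : (n : ℝ) ^ 2 * |g ⌊x * n⌋ - g ⌊p * n⌋| ≤ c₀ / 2 * n := by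
    have hCδn : C * δ * n ≤ c₀ / 4 * n := mul_le_mul_of_nonneg_right hCδ hn'.le
    calc _ ≤ C * (δ * n + 1) := key
      _ = C * δ * n + C := by ring
      _ ≤ c₀ / 4 * n + c₀ / 4 * n := add_le_add hCδn hCn
      _ = c₀ / 2 * n := by ring
  have h2 : (n : ℝ) * |g ⌊x * n⌋ - g ⌊p * n⌋| ≤ c₀ / 2 := by
    refine le_of_mul_le_mul_left ?_ hn'
    calc (n : ℝ) * ((n : ℝ) * |g ⌊x * n⌋ - g ⌊p * n⌋|)
        = (n : ℝ) ^ 2 * |g ⌊x * n⌋ - g ⌊p * n⌋| := by ring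
      _ ≤ c₀ / 2 * n := h1
      _ = (n : ℝ) * (c₀ / 2) := mul_comm _ _
  have h3 : (n : ℝ) * g ⌊p * n⌋ - n * g ⌊x * n⌋ ≤ (n : ℝ) * |g ⌊x * n⌋ - g ⌊p * n⌋| := by
    rw [← mul_sub]
    exact mul_le_mul_of_nonneg_left ((le_abs_self _).trans (abs_sub_comm _ _).le) hn'.le
  linarith

/-- **UNIFORM POSITIVITY OF THE LATTICE MARK DENSITY ON COMPACT INTERVALS OF THE FOURTH MARK**
(registered stub `stub_lawSeq_uniformPos` of line `Sketch`, a-priori programme): for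
`a < b < c < x₀ ≤ x₁` there is `c₁ > 0` with `c₁ ≤ n · P_{1/2}[E_n(a,b,c,x)]` for all `x ∈ [x₀, x₁]`
and all large `n`, the threshold being uniform in `x`.  Pointwise positivity + uniform lattice
Lipschitz bound in the fourth mark + compactness. [folklore] -/
theorem stub_lawSeq_uniformPos : ∀ (a b c x₀ x₁ : ℝ), a < b → b < c → c < x₀ → x₀ ≤ x₁ → ∃ c₁ : ℝ, 0 < c₁ ∧ ∀ᶠ n : ℕ in atTop, ∀ x ∈ Set.Icc x₀ x₁, c₁ ≤ lawSeq a b c x n := by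
  intro a b c x₀ x₁ hab hbc hcx hx₀₁
  -- the separation scale `ε`: `4ε = min (b − a, c − b, x₀ − c)`
  obtain ⟨ε, hε, hεab, hεbc, hεcx⟩ :
      ∃ ε : ℝ, 0 < ε ∧ 4 * ε ≤ b - a ∧ 4 * ε ≤ c - b ∧ 4 * ε ≤ x₀ - c := by
    refine ⟨min (min (b - a) (c - b)) (x₀ - c) / 4, ?_, ?_, ?_, ?_⟩
    · have : 0 < min (min (b - a) (c - b)) (x₀ - c) :=
        lt_min (lt_min (by linarith) (by linarith)) (by linarith)
      positivity
    · have : min (min (b - a) (c - b)) (x₀ - c) ≤ b - a := (min_le_left _ _).trans (min_le_left _ _)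
      linarith
    · have : min (min (b - a) (c - b)) (x₀ - c) ≤ c - b :=
        (min_le_left _ _).trans (min_le_right _ _)
      linarith
    · have : min (min (b - a) (c - b)) (x₀ - c) ≤ x₀ - c := min_le_right _ _
      linarith
  -- the uniform Lipschitz constant `C` (reference point `x₀`)
  obtain ⟨C, hC0, hC⟩ := Density.uniformShiftLipschitz hε
  have hL := hC a b c x₀ hεab hεbc hεcx
  -- pointwise positivity, as choice functions on `(c, ∞)`
  choose! cf hcf0 hcfev using
    fun (p : ℝ) (hp : c < p) ↦ TwoArmLower.stub_densityPositivity a b c p hab hbc hp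
  -- the threshold `C ≤ (c(p)/4) · n`
  have hthr : ∀ p : ℝ, c < p → ∀ᶠ n : ℕ in atTop, C ≤ cf p / 4 * n := by
    intro p hp
    have h4 : 0 < cf p / 4 := by have := hcf0 p hp; positivity
    obtain ⟨N, hN⟩ := exists_nat_ge (C / (cf p / 4))
    filter_upwards [eventually_ge_atTop N] with n hn
    have h1 : (N : ℝ) ≤ n := by exact_mod_cast hn
    exact ((div_le_iff₀ h4).1 (hN.trans h1)).trans_eq (mul_comm _ _)
  -- LOCAL STEP: on the ball `B(p, δ(p))`, `δ(p) = c(p) / (4 (C + 1))`, uniformly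
  have hloc : ∀ p : ℝ, x₀ ≤ p → ∀ᶠ n : ℕ in atTop, ∀ x : ℝ, x₀ ≤ x →
      |x - p| < cf p / (4 * (C + 1)) → cf p / 2 ≤ lawSeq a b c x n := by
    intro p hp
    have hcp : c < p := hcx.trans_le hp
    have h0 := hcf0 p hcp
    have hCδ : C * (cf p / (4 * (C + 1))) ≤ cf p / 4 := by
      rw [mul_div_assoc', div_le_div_iff₀ (by positivity) (by positivity)]
      nlinarith
    filter_upwards [hcfev p hcp, hthr p hcp, eventually_ge_atTop 1] with n hn hCn hn1 x hx hxp
    rw [Density.lawSeq_eq] at hn ⊢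
    exact half_le_of_shiftLipschitz
      (g := fun k ↦ μ.real (firstHit halfPlane (arcA a b n) ⌊c * n⌋ k)) hn1 hC0 (hL n hn1) hp hx
      hxp.le hCδ hCn hn
  -- COMPACTNESS of `[x₀, x₁]`
  obtain ⟨t, hts, hcover⟩ := (isCompact_Icc (a := x₀) (b := x₁)).elim_nhds_subcover
    (fun p ↦ Metric.ball p (cf p / (4 * (C + 1)))) (fun p hp ↦ Metric.ball_mem_nhds p (by
      have := hcf0 p (hcx.trans_le hp.1)
      positivity))
  have htne : t.Nonempty := by
    obtain ⟨p, hp, -⟩ := Set.mem_iUnion₂.1 (hcover (⟨le_rfl, hx₀₁⟩ : x₀ ∈ Icc x₀ x₁))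
    exact ⟨p, hp⟩
  refine ⟨t.inf' htne (fun p ↦ cf p / 2), ?_, ?_⟩
  · exact (Finset.lt_inf'_iff _).2 fun p hp ↦ half_pos (hcf0 p (hcx.trans_le (hts p hp).1))
  · have hall : ∀ᶠ n : ℕ in atTop, ∀ p ∈ t, ∀ x : ℝ, x₀ ≤ x →
        |x - p| < cf p / (4 * (C + 1)) → cf p / 2 ≤ lawSeq a b c x n :=
      (Filter.eventually_all_finset t).2 fun p hp ↦ hloc p (hts p hp).1
    filter_upwards [hall] with n hn x hx
    obtain ⟨p, hp, hxball⟩ := Set.mem_iUnion₂.1 (hcover hx)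
    rw [Metric.mem_ball, Real.dist_eq] at hxball
    exact (Finset.inf'_le _ hp).trans (hn p hp x hx.1 hxball)

end Apriori

end Summit.CriticalPhenomena.CardyFormulaZ2.Cruxes.HalfPlaneMarkDensityLaw.SketchLine

end
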